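import Literature.Geometry.PolyhedralFans.LatticePoints
import Mathlib.LinearAlgebra.FreeModule.PID
import Mathlib.RingTheory.Localization.Module
import Mathlib.LinearAlgebra.FiniteDimensional.Lemmas
import HarnessLib

/-!
# Crux `FrobeniusLadder.FRationalResolution` (stmt-ResolutionOfSingularities-15317), line `redirect`,
# stub `stub_diagonalizableQuotientResolution` — a ℤ-BASIS OF THE DUAL LATTICE (lane W‴, brick T0)

The ladder theorems (`…EquivariantLadder`, `…SafeLadder`, ✓ p831219/p831580) live in the fan library's coordinates, where
the lattice is the standard `ℤⁿ ⊆ ℚⁿ` (`latticeN`). Lane W‴ starts from the DUAL LATTICE `N ⊇ ℤⁿ` of the weight-`0`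
exponents of the quotient chart (`N ⊆ (1/d) ℤⁿ` for `d` the exponent of the weight group). This file supplies the change
of coordinates `φ : ℚⁿ ≅ ℚⁿ` with `v ∈ N ↔ φ v ∈ ℤⁿ` (hypothesis `hφ` of `…SafeLadder.exists_equivariant_projective_ladder_safe`):
a ℤ-submodule squeezed between `ℤⁿ` and `(1/d) ℤⁿ` is free of rank `n` (structure theorem over the PID `ℤ`,
`Submodule.basisOfPidOfLESpan`) and any of its ℤ-bases is a ℚ-basis of `ℚⁿ` (`LinearIndependent.iff_fractionRing`).

* `mem_span_scaled_single` — `N ≤ span_ℤ {e_l / d}`;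
* **`exists_linearEquiv_mem_iff_latticeN`** — the coordinate change `φ`.

Honest label: linear algebra bookkeeping for the DESIGN W‴ (brick T0 of memo MEMO-15317-leafhand4-g6 §4). No stub closed by
name. No definitions, no named facts, no sorry. [folklore; cite: Fulton1993Toric, §2.1 p. 29]
-/

-- single-problem summit: the doubled namespace component is forced
set_option linter.dupNamespace false

namespace Summit.ResolutionOfSingularities.ResolutionOfSingularities.Theorems.FRationalResolution.DualLatticeBasis

open Literature.Geometry.PolyhedralFans Module

variable {n : ℕ}

/-- The scaled coordinate vectors `e_l / d` are `ℚ`-linearly independent. [folklore] -/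
theorem linearIndependent_scaled_single (d : ℕ) (hd : 0 < d) :
    LinearIndependent ℚ (fun l : Fin n => ((1 : ℚ) / d) • (Pi.single l (1 : ℚ) : Fin n → ℚ)) := by
  have hd' : ((1 : ℚ) / d) ≠ 0 := by positivity
  have h := (Pi.basisFun ℚ (Fin n)).linearIndependent.units_smul (fun _ => Units.mk0 _ hd')
  convert h using 1
  ext l i
  simp [Pi.basisFun_apply, Units.smul_def]

/-- **`N ≤ span_ℤ {e_l / d}`**: a vector `v` with `d • v ∈ ℤⁿ` is the integral combination `Σ_l (d v_l) • (e_l / d)`.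
[folklore] -/
theorem mem_span_scaled_single (d : ℕ) (hd : 0 < d) {v : Fin n → ℚ} (hv : ((d : ℚ) • v) ∈ latticeN (Fin n)) :
    v ∈ Submodule.span ℤ (Set.range fun l : Fin n => ((1 : ℚ) / d) • (Pi.single l (1 : ℚ) : Fin n → ℚ)) := by
  rw [mem_latticeN_iff] at hv
  choose z hz using hv
  have hd' : (d : ℚ) ≠ 0 := by positivity
  have hveq : v = ∑ l : Fin n, (z l) • (((1 : ℚ) / d) • (Pi.single l (1 : ℚ) : Fin n → ℚ)) := by
    ext i
    rw [Finset.sum_apply]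
    have hi := hz i
    simp only [Pi.smul_apply, smul_eq_mul] at hi
    simp only [Pi.smul_apply, Pi.single_apply, smul_eq_mul, mul_ite, mul_one, mul_zero, zsmul_eq_mul]
    rw [Finset.sum_eq_single i (fun b _ hb => by simp [Ne.symm hb]) (fun h => absurd (Finset.mem_univ i) h)]
    simp only [if_true]
    rw [← hi]
    field_simp
  rw [hveq]
  exact Submodule.sum_mem _ fun l _ => Submodule.smul_mem _ _ (Submodule.subset_span ⟨l, rfl⟩)

/-- **A ℤ-basis of the dual lattice (brick T0).** Let `N ⊆ ℚⁿ` be a `ℤ`-submodule containing the coordinate vectors and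
contained in `(1/d) ℤⁿ` (`d • N ⊆ ℤⁿ`, `d > 0`). Then there is a `ℚ`-linear automorphism `φ` of `ℚⁿ` with
`v ∈ N ↔ φ v ∈ ℤⁿ` — namely the coordinate map of a `ℤ`-basis of `N`, which is a `ℚ`-basis of `ℚⁿ`.
[folklore; cite: Fulton1993Toric, §2.1 p. 29] -/
theorem exists_linearEquiv_mem_iff_latticeN (N : Submodule ℤ (Fin n → ℚ))
    (hsub : ∀ l : Fin n, (Pi.single l (1 : ℚ) : Fin n → ℚ) ∈ N) (d : ℕ) (hd : 0 < d)
    (hN : ∀ v ∈ N, ((d : ℚ) • v) ∈ latticeN (Fin n)) :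
    ∃ φ : (Fin n → ℚ) ≃ₗ[ℚ] (Fin n → ℚ), ∀ v, v ∈ N ↔ φ v ∈ latticeN (Fin n) := by
  classical
  -- `N` sits inside the free module `span_ℤ {e_l / d}`, hence is free of finite rank
  have hliQ := linearIndependent_scaled_single (n := n) d hd
  have hliZ : LinearIndependent ℤ (fun l : Fin n => ((1 : ℚ) / d) • (Pi.single l (1 : ℚ) : Fin n → ℚ)) :=
    (LinearIndependent.iff_fractionRing ℤ ℚ).2 hliQ
  have hNO : N ≤ Submodule.span ℤ (Set.range fun l : Fin n => ((1 : ℚ) / d) • (Pi.single l (1 : ℚ) : Fin n → ℚ)) :=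
    fun v hv => mem_span_scaled_single d hd (hN v hv)
  obtain ⟨m, bN⟩ := Submodule.basisOfPidOfLESpan hliZ hNO
  -- the basis vectors, as vectors of `ℚⁿ`, are `ℚ`-linearly independent and span
  have huZ : LinearIndependent ℤ (fun i => (bN i : Fin n → ℚ)) :=
    bN.linearIndependent.map' N.subtype (Submodule.ker_subtype N)
  have huQ : LinearIndependent ℚ (fun i => (bN i : Fin n → ℚ)) := (LinearIndependent.iff_fractionRing ℤ ℚ).1 huZ
  -- coordinates over `bN` give rational expansions
  have hexp : ∀ x : N, (x : Fin n → ℚ) = ∑ i, ((bN.repr x i : ℤ) : ℚ) • (bN i : Fin n → ℚ) := by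
    intro x
    have h := congrArg (fun y : N => (y : Fin n → ℚ)) (bN.sum_repr x)
    simp only [Submodule.coe_sum, Submodule.coe_smul_of_tower] at h
    refine h.symm.trans (Finset.sum_congr rfl fun i _ => ?_)
    rw [Int.cast_smul_eq_zsmul]
  have hspan : ⊤ ≤ Submodule.span ℚ (Set.range fun i => (bN i : Fin n → ℚ)) := by
    have hsingle : ∀ l : Fin n, (Pi.single l (1 : ℚ) : Fin n → ℚ) ∈
        Submodule.span ℚ (Set.range fun i => (bN i : Fin n → ℚ)) := by
      intro l
      rw [show (Pi.single l (1 : ℚ) : Fin n → ℚ) = ((⟨Pi.single l 1, hsub l⟩ : N) : Fin n → ℚ) from rfl,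
        hexp ⟨Pi.single l 1, hsub l⟩]
      exact Submodule.sum_mem _ fun i _ => Submodule.smul_mem _ _ (Submodule.subset_span ⟨i, rfl⟩)
    intro x _
    rw [← Finset.univ_sum_single x]
    refine Submodule.sum_mem _ fun l _ => ?_
    have : (Pi.single l (x l) : Fin n → ℚ) = x l • (Pi.single l (1 : ℚ) : Fin n → ℚ) := by
      ext i; simp [Pi.single_apply]
    rw [this]
    exact Submodule.smul_mem _ _ (hsingle l)
  let bQ : Basis (Fin m) ℚ (Fin n → ℚ) := Basis.mk huQ hspan
  have hbQ : ∀ i, bQ i = (bN i : Fin n → ℚ) := fun i => by simp [bQ]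
  -- `m = n`
  have hmn : m = n := by
    have h1 := Module.finrank_eq_card_basis bQ
    rw [Module.finrank_fin_fun, Fintype.card_fin] at h1
    exact h1.symm
  subst hmn
  refine ⟨bQ.equivFun, fun v => ⟨fun hv => ?_, fun hv => ?_⟩⟩
  · -- a vector of `N` has integral coordinates
    have hcoord : bQ.equivFun v = fun i => ((bN.repr ⟨v, hv⟩ i : ℤ) : ℚ) := by
      apply bQ.equivFun.symm.injective
      rw [LinearEquiv.symm_apply_apply, Basis.equivFun_symm_apply]
      have hv' := hexp ⟨v, hv⟩
      simp only at hv'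
      exact hv'.trans (Finset.sum_congr rfl fun i _ => by rw [hbQ])
    rw [hcoord, mem_latticeN_iff]
    exact fun i => ⟨bN.repr ⟨v, hv⟩ i, rfl⟩
  · -- integral coordinates give a vector of `N`
    rw [mem_latticeN_iff] at hv
    choose z hz using hv
    have hveq : v = ∑ i, (z i : ℚ) • (bN i : Fin m → ℚ) := by
      have h := bQ.equivFun.symm_apply_apply v
      rw [Basis.equivFun_symm_apply] at h
      rw [← h]
      exact Finset.sum_congr rfl fun i _ => by rw [hz i, hbQ]
    rw [hveq]
    refine Submodule.sum_mem _ fun i _ => ?_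
    rw [Int.cast_smul_eq_zsmul]
    exact Submodule.smul_mem _ _ (bN i).2

end Summit.ResolutionOfSingularities.ResolutionOfSingularities.Theorems.FRationalResolution.DualLatticeBasis
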